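import Summits.Schanuel.Schanuel.Theorems.ZilberEacComplexCyclicCover
import HarnessLib

/-!
# EC over cyclic covers `xₙ^e = P(x')`: the root form of the hypothesis

`ZilberEacComplexCyclicCover.lean` proves Exponential-Algebraic Closedness for the `(s+1)`-folds
`V = {xₙ^e = P(x'), (x', (yⱼ - yₙ Fⱼ(yₙ, xₙ, x'))ⱼ) ∈ W}` (Brownawell–Masser puncture fibre `W`)
from one lattice direction `q₀` with `P_D(2πi q₀)` off the cut `(-∞,0]` and
`Re(ω P_D(2πi q₀)^{1/e}) < 0` for a root of unity `ω` (principal `e`-th root). This file removes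
the dependence on the principal branch: it suffices that **some `e`-th root `τ` of `P_D(2πi q₀)`
has negative real part** (`exists_expPoint_cyclicCoverBM_avoiding_of_root`). For `e = 1` this is
exactly the hypothesis `Re g_D(2πi q₀) < 0` of `exists_expPoint_punctureBM_avoiding`; for `e ≥ 3`
it only asks `P_D(2πi q₀) ≠ 0` up to the choice of `τ`; the residual case (every `e`-th root of
every non-zero `P_D(2πi q)` purely imaginary: `e ≤ 2`, `i^e P_D(2πi q) ∈ ℝ_{>0}`-type sign
patterns) is the oscillatory regime, open here.

* `exists_expPoint_cyclicCoverBM_avoiding_gen` — the engine with an arbitrary constant `ω`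
  (conclusion `xₙ^e = ω^e P(x')`);
* `exists_expPoint_cyclicCoverBM_avoiding_of_root` — the root form (`τ^e = P_D(2πi q₀)`,
  `Re τ < 0`), via the rescaled polynomial `τ^{-e} P` whose leading value at `2πi q₀` is `1`.

First open rung of EAC (`dim π₁ V = n - 1`): Mantova–Masser, PLMS 129 (2024), §1 p. 5.
HONEST FRAMING: a modest new sub-rung of EAC; nothing here bears on Schanuel's conjecture.
-/

noncomputable section

open Complex MvPolynomial Metric Set Filter Topology
open Literature.NumberTheory.Transcendental

set_option linter.dupNamespace false

namespace Summit.Schanuel.Schanuel.Theorems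

/-- **EC over `xₙ^e = ω^e P(x')` with Brownawell–Masser puncture fibre (engine with a free
constant).** As `exists_expPoint_cyclicCoverBM_avoiding`, but for an arbitrary `ω ∈ ℂ` (no
`ω^e = 1`), with conclusion `xₙ^e = ω^e · P(x')`: the branch is `xₙ = ω · P(x')^{1/e}` along a
lattice ray with `P_D(2πi q₀) ∉ (-∞, 0]` and `Re(ω P_D(2πi q₀)^{1/e}) < 0`.
[cite: MantovaMasser2023, §1 p.5 (the open case dim π(V) = 2 in ℂ³×ℂˣ³)] -/
theorem exists_expPoint_cyclicCoverBM_avoiding_gen {s : ℕ} {e : ℕ} (he : 0 < e)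
    (P : MvPolynomial (Fin s) ℂ) (hD : 0 < P.totalDegree) (q₀ : Fin s → ℤ) (ω : ℂ)
    (hslit : eval (fun j => 2 * Real.pi * I * (q₀ j : ℂ))
      (homogeneousComponent P.totalDegree P) ∈ slitPlane)
    (hsign : (ω * (eval (fun j => 2 * Real.pi * I * (q₀ j : ℂ))
      (homogeneousComponent P.totalDegree P)) ^ ((e : ℂ)⁻¹)).re < 0)
    (W : Set (Fin s ⊕ Fin s → ℂ)) (hW : IsIrreducibleClosed ℂ W) (hdim : zariskiDim ℂ W = s)
    (hdom : HasDominantAddProjection ℂ (W ∩ torusLocus ℂ s))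
    (F : Fin s → MvPolynomial (Fin (s + 2)) ℂ) (h : MvPolynomial (Fin s) ℂ) (hh : h ≠ 0) :
    ∃ x : Fin s → ℂ, ∃ xn : ℂ, eval x h ≠ 0 ∧ xn ^ e = ω ^ e * eval x P ∧
      (Sum.elim x (fun j => exp (x j) - exp xn *
        eval (Fin.cons (exp xn) (Fin.cons xn x : Fin (s + 1) → ℂ)) (F j)) : Fin s ⊕ Fin s → ℂ) ∈ W := by
  classical
  set D := P.totalDegree with hDdef
  set Pd := homogeneousComponent D P with hPd
  have hPdhom : Pd.IsHomogeneous D := homogeneousComponent_isHomogeneous D P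
  -- admissible directions
  set adm : (Fin s → ℤ) → Prop := fun q =>
    eval (fun j => 2 * Real.pi * I * (q j : ℂ)) Pd ∈ slitPlane ∧
      (ω * (eval (fun j => 2 * Real.pi * I * (q j : ℂ)) Pd) ^ ((e : ℂ)⁻¹)).re < 0 with hadm
  have hcone : ∀ t : ℝ, 0 < t → ∀ w : Fin s → ℂ,
      (eval w Pd ∈ slitPlane ∧ (ω * (eval w Pd) ^ ((e : ℂ)⁻¹)).re < 0) →
      (eval ((t : ℂ) • w) Pd ∈ slitPlane ∧ (ω * (eval ((t : ℂ) • w) Pd) ^ ((e : ℂ)⁻¹)).re < 0) := by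
    rintro t ht w ⟨hw1, hw2⟩
    have htD : (0 : ℝ) < t ^ D := pow_pos ht D
    have hev : eval ((t : ℂ) • w) Pd = ((t ^ D : ℝ) : ℂ) * eval w Pd := by
      rw [hPdhom.eval_smul_eq, Complex.ofReal_pow]
    refine ⟨by rw [hev]; exact ofReal_mul_mem_slitPlane htD hw1, ?_⟩
    rw [hev, Literature.Geometry.ComplexAnalytic.PhamBrieskorn.natCast_inv_eq, re_mul_ofReal_mul_cpow htD (slitPlane_ne_zero hw1)]
    rw [Literature.Geometry.ComplexAnalytic.PhamBrieskorn.natCast_inv_eq] at hw2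
    exact mul_neg_of_pos_of_neg (Real.rpow_pos_of_pos htD _) hw2
  have hadm_all : ∀ Q : MvPolynomial (Fin s) ℂ, Q ≠ 0 →
      ∃ q, adm q ∧ eval (fun j => 2 * Real.pi * I * (q j : ℂ)) Q ≠ 0 := by
    intro Q hQ
    obtain ⟨q, hqQ, hq⟩ := exists_good_direction_of_isOpen_cone Q hQ
      (fun w => eval w Pd ∈ slitPlane ∧ (ω * (eval w Pd) ^ ((e : ℂ)⁻¹)).re < 0)
      (isOpen_cyclicRoot_cone Pd e ω) hcone q₀ ⟨hslit, hsign⟩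
    exact ⟨q, hq, hqQ⟩
  -- the branch and its radius
  set φ : (Fin s → ℤ) → ℕ → (Fin s → ℂ) → ℂ := fun _ _ z => ω * (eval z P) ^ ((e : ℂ)⁻¹) with hφ
  have hctrl : ∀ q, adm q → ∃ ρ : ℝ, 0 < ρ ∧ ∃ c : ℝ, 0 < c ∧ ∃ t₀ : ℝ, 1 ≤ t₀ ∧
      ∀ m : ℕ, t₀ ≤ (m : ℝ) → ∀ z ∈ ball ((m : ℂ) • fun j => 2 * Real.pi * I * (q j : ℂ)) (ρ * m),
        eval z P ∈ slitPlane ∧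
        (ω * (eval z P) ^ ((e : ℂ)⁻¹)).re ≤ -(c * (m : ℝ) ^ ((D : ℝ) / e)) ∧
        ‖(eval z P) ^ ((e : ℂ)⁻¹)‖ ≤ 1 + ‖eval z P‖ :=
    fun q hq => cyclicRoot_control P _ hq.1 he ω hq.2
  set ρ : (Fin s → ℤ) → ℝ := fun q => if hq : adm q then Classical.choose (hctrl q hq) else 1
    with hρ
  have hρspec : ∀ q (hq : adm q), 0 < ρ q ∧ ∃ c : ℝ, 0 < c ∧ ∃ t₀ : ℝ, 1 ≤ t₀ ∧
      ∀ m : ℕ, t₀ ≤ (m : ℝ) → ∀ z ∈ ball ((m : ℂ) • fun j => 2 * Real.pi * I * (q j : ℂ)) (ρ q * m),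
        eval z P ∈ slitPlane ∧
        (ω * (eval z P) ^ ((e : ℂ)⁻¹)).re ≤ -(c * (m : ℝ) ^ ((D : ℝ) / e)) ∧
        ‖(eval z P) ^ ((e : ℂ)⁻¹)‖ ≤ 1 + ‖eval z P‖ := by
    intro q hq
    have h1 : ρ q = Classical.choose (hctrl q hq) := by simp only [hρ, dif_pos hq]
    rw [h1]
    exact Classical.choose_spec (hctrl q hq)
  -- growth of `P`
  obtain ⟨CP, hCP, NP, hCNP⟩ :=
    Literature.NumberTheory.Transcendental.HypersurfaceCover.exists_norm_eval_le_pow P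
  -- hypotheses of the abstract theorem
  have hφhyp : ∀ q, adm q → 0 < ρ q ∧ ∃ K : ℝ, 0 ≤ K ∧ ∃ Nφ : ℕ, ∀ᶠ m : ℕ in atTop,
      DifferentiableOn ℂ (φ q m)
        (ball ((m : ℂ) • fun i => 2 * Real.pi * I * (q i : ℂ)) (ρ q * m)) ∧
      ∀ z ∈ ball ((m : ℂ) • fun i => 2 * Real.pi * I * (q i : ℂ)) (ρ q * m),
        ‖φ q m z‖ ≤ K * (m : ℝ) ^ Nφ := by
    intro q hq
    obtain ⟨hρq, c, hc, t₀, ht₀, hball⟩ := hρspec q hq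
    set vq : Fin s → ℂ := fun i => 2 * Real.pi * I * (q i : ℂ) with hvq
    set K : ℝ := ‖ω‖ * (1 + CP * (2 + ‖vq‖ + ρ q) ^ NP) with hK
    refine ⟨hρq, K, by positivity, NP, ?_⟩
    filter_upwards [tendsto_natCast_atTop_atTop.eventually_ge_atTop t₀] with m hm
    have hm1 : (1 : ℝ) ≤ m := ht₀.trans hm
    have hm0 : (0 : ℝ) < m := by linarith
    have hfacts := hball m hm
    refine ⟨?_, fun z hz => ?_⟩
    · -- holomorphy: `P(z)` stays in the slit plane on the ball
      have hmaps : MapsTo (fun z : Fin s → ℂ => eval z P)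
          (ball ((m : ℂ) • vq) (ρ q * m)) slitPlane := fun z hz => (hfacts z hz).1
      exact ((differentiable_mvPolynomial_eval P).differentiableOn.cpow
        (differentiableOn_const _) hmaps).const_mul ω
    · obtain ⟨-, -, hnorm⟩ := hfacts z hz
      rw [mem_ball, dist_eq_norm] at hz
      have hzn : ‖z‖ ≤ (‖vq‖ + ρ q) * m := by
        calc ‖z‖ = ‖(m : ℂ) • vq + (z - (m : ℂ) • vq)‖ := by rw [add_sub_cancel]
          _ ≤ ‖(m : ℂ) • vq‖ + ‖z - (m : ℂ) • vq‖ := norm_add_le _ _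
          _ ≤ m * ‖vq‖ + ρ q * m := by
              rw [norm_smul, Complex.norm_natCast]; exact add_le_add le_rfl hz.le
          _ = (‖vq‖ + ρ q) * m := by ring
      have hPz : ‖eval z P‖ ≤ CP * ((2 + ‖vq‖ + ρ q) * m) ^ NP := by
        refine (hCNP z).trans (mul_le_mul_of_nonneg_left ?_ hCP)
        refine pow_le_pow_left₀ (by positivity) ?_ _
        have := norm_nonneg vq
        nlinarith
      have hmN : (1 : ℝ) ≤ (m : ℝ) ^ NP := one_le_pow₀ hm1
      calc ‖φ q m z‖ = ‖ω‖ * ‖(eval z P) ^ ((e : ℂ)⁻¹)‖ := norm_mul _ _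
        _ ≤ ‖ω‖ * (1 + CP * ((2 + ‖vq‖ + ρ q) * m) ^ NP) :=
            mul_le_mul_of_nonneg_left (hnorm.trans (by linarith)) (norm_nonneg _)
        _ ≤ ‖ω‖ * ((1 + CP * (2 + ‖vq‖ + ρ q) ^ NP) * (m : ℝ) ^ NP) := by
            refine mul_le_mul_of_nonneg_left ?_ (norm_nonneg _)
            rw [mul_pow]
            have : 0 ≤ CP * (2 + ‖vq‖ + ρ q) ^ NP := by positivity
            nlinarith
        _ = K * (m : ℝ) ^ NP := by rw [hK]; ring
  have hdecay : ∀ q, adm q → ∀ Nd : ℕ, ∀ᶠ m : ℕ in atTop,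
      ∀ z ∈ ball ((m : ℂ) • fun i => 2 * Real.pi * I * (q i : ℂ)) (ρ q * m),
        (φ q m z).re ≤ -(Nd * Real.log m) := by
    intro q hq Nd
    obtain ⟨hρq, c, hc, t₀, ht₀, hball⟩ := hρspec q hq
    have hr : (0 : ℝ) < (D : ℝ) / e := by positivity
    -- `Nd log m ≤ c m^{D/e}` eventually
    have hlo := (isLittleO_log_rpow_atTop hr).def (show (0 : ℝ) < c / (Nd + 1) by positivity)
    have hev : ∀ᶠ m : ℕ in atTop, (Nd : ℝ) * Real.log m ≤ c * (m : ℝ) ^ ((D : ℝ) / e) := by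
      filter_upwards [tendsto_natCast_atTop_atTop.eventually hlo,
        tendsto_natCast_atTop_atTop.eventually_ge_atTop (1 : ℝ)] with m hm hm1
      rw [Real.norm_of_nonneg (Real.log_nonneg hm1),
        Real.norm_of_nonneg (Real.rpow_nonneg (by linarith) _)] at hm
      have hpos : (0 : ℝ) ≤ (m : ℝ) ^ ((D : ℝ) / e) := Real.rpow_nonneg (by linarith) _
      have hlog0 : 0 ≤ Real.log m := Real.log_nonneg hm1
      have h1 : (Nd : ℝ) * Real.log m ≤ (Nd + 1) * Real.log m := by nlinarith
      have h2 : ((Nd : ℝ) + 1) * (c / (Nd + 1) * (m : ℝ) ^ ((D : ℝ) / e)) =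
          c * (m : ℝ) ^ ((D : ℝ) / e) := by field_simp
      nlinarith
    filter_upwards [hev, tendsto_natCast_atTop_atTop.eventually_ge_atTop t₀] with m hm hmt
    intro z hz
    exact (hball m hmt z hz).2.1.trans (by linarith)
  obtain ⟨q, hq, m, x, hxball, hxh, hxW⟩ := exists_expPoint_branchBM_avoiding W hW hdim hdom adm
    hadm_all ρ φ hφhyp hdecay F h hh
  refine ⟨x, φ q m x, hxh, ?_, hxW⟩
  -- `(ω P^{1/e})^e = ω^e P`
  show (ω * (eval x P) ^ ((e : ℂ)⁻¹)) ^ e = ω ^ e * eval x P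
  rw [mul_pow, Complex.cpow_nat_inv_pow _ he.ne']


/-- Total degree is unchanged by a non-zero constant factor. [folklore] -/
theorem totalDegree_C_mul_of_ne_zero {s : ℕ} {c : ℂ} (hc : c ≠ 0) (P : MvPolynomial (Fin s) ℂ) :
    (C c * P).totalDegree = P.totalDegree := by
  refine le_antisymm ((totalDegree_mul _ _).trans (by rw [totalDegree_C, zero_add])) ?_
  have h : P = C c⁻¹ * (C c * P) := by
    rw [← mul_assoc, ← C_mul, inv_mul_cancel₀ hc, C_1, one_mul]
  conv_lhs => rw [h]
  exact (totalDegree_mul _ _).trans (by rw [totalDegree_C, zero_add])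

/-- **EC over a cyclic cover `xₙ^e = P(x')` with Brownawell–Masser puncture fibre — root form.**
Let `e ≥ 1`, `P ∈ ℂ[x₁..xₛ]` of degree `D ≥ 1`, and suppose that for some lattice direction
`q₀ ∈ ℤˢ` some `e`-th root `τ` of `P_D(2πi q₀)` has `Re τ < 0`. Let `W ⊆ ℂˢ × ℂˢ` be a
Brownawell–Masser variety and `Fⱼ ∈ ℂ[u, w, x']`, `h ≠ 0` arbitrary. Then there are `x'`, `xₙ` with
`h(x') ≠ 0`, `xₙ^e = P(x')` and `(x', (e^{xⱼ} - e^{xₙ} Fⱼ(e^{xₙ}, xₙ, x'))ⱼ) ∈ W`: the `(s+1)`-fold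
`{xₙ^e = P(x'), (x', (yⱼ - yₙ Fⱼ(yₙ, xₙ, x'))ⱼ) ∈ W}` meets the graph of `exp`, with exponential
points Zariski dense over the base. (`e = 1`: the graph case, hypothesis `Re P_D(2πi q₀) < 0`;
`e ≥ 3`: every `P_D(2πi q₀) ≠ 0` has such a root.) Proof: `exists_expPoint_cyclicCoverBM_avoiding_gen`
for the rescaled polynomial `τ^{-e} P` (leading value `1` at `2πi q₀`) with `ω = τ`. New.
[cite: MantovaMasser2023, §1 p.5 (the open case dim π(V) = 2 in ℂ³×ℂˣ³)] -/
theorem exists_expPoint_cyclicCoverBM_avoiding_of_root {s : ℕ} {e : ℕ} (he : 0 < e)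
    (P : MvPolynomial (Fin s) ℂ) (hD : 0 < P.totalDegree) (q₀ : Fin s → ℤ) (τ : ℂ)
    (hτ : τ ^ e = eval (fun j => 2 * Real.pi * I * (q₀ j : ℂ)) (homogeneousComponent P.totalDegree P))
    (hre : τ.re < 0)
    (W : Set (Fin s ⊕ Fin s → ℂ)) (hW : IsIrreducibleClosed ℂ W) (hdim : zariskiDim ℂ W = s)
    (hdom : HasDominantAddProjection ℂ (W ∩ torusLocus ℂ s))
    (F : Fin s → MvPolynomial (Fin (s + 2)) ℂ) (h : MvPolynomial (Fin s) ℂ) (hh : h ≠ 0) :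
    ∃ x : Fin s → ℂ, ∃ xn : ℂ, eval x h ≠ 0 ∧ xn ^ e = eval x P ∧
      (Sum.elim x (fun j => exp (x j) - exp xn *
        eval (Fin.cons (exp xn) (Fin.cons xn x : Fin (s + 1) → ℂ)) (F j)) : Fin s ⊕ Fin s → ℂ) ∈ W := by
  have hτ0 : τ ≠ 0 := by
    intro h0; rw [h0, Complex.zero_re] at hre; exact lt_irrefl _ hre
  have hτe : τ ^ e ≠ 0 := pow_ne_zero _ hτ0
  set c : ℂ := (τ ^ e)⁻¹ with hc
  have hc0 : c ≠ 0 := inv_ne_zero hτe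
  set P' : MvPolynomial (Fin s) ℂ := C c * P with hP'
  have hdeg : P'.totalDegree = P.totalDegree := totalDegree_C_mul_of_ne_zero hc0 P
  have htop : eval (fun j => 2 * Real.pi * I * (q₀ j : ℂ)) (homogeneousComponent P'.totalDegree P') = 1 := by
    rw [hdeg, hP', homogeneousComponent_C_mul, map_mul, eval_C, ← hτ, hc, inv_mul_cancel₀ hτe]
  have hslit : eval (fun j => 2 * Real.pi * I * (q₀ j : ℂ))
      (homogeneousComponent P'.totalDegree P') ∈ slitPlane := by
    rw [htop]; exact Complex.one_mem_slitPlane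
  have hsign : (τ * (eval (fun j => 2 * Real.pi * I * (q₀ j : ℂ))
      (homogeneousComponent P'.totalDegree P')) ^ ((e : ℂ)⁻¹)).re < 0 := by
    rw [htop, Complex.one_cpow, mul_one]; exact hre
  obtain ⟨x, xn, hxh, hxn, hx⟩ := exists_expPoint_cyclicCoverBM_avoiding_gen he P' (by rw [hdeg]; exact hD)
    q₀ τ hslit hsign W hW hdim hdom F h hh
  refine ⟨x, xn, hxh, ?_, hx⟩
  rw [hxn, hP', map_mul, eval_C, hc, ← mul_assoc, mul_inv_cancel₀ hτe, one_mul]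

end Summit.Schanuel.Schanuel.Theorems
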